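import Summits.CriticalPhenomena.PercolationContinuityZ3.Theorems.PercNearOneGluingNoHeavyQuantFlowUncross
import HarnessLib

/-!
# QUANT lane R8, T-DEC: bookkeeping for the CORNER STEP of the flow form of DEC (LEAD-NOTES-G21 N45 (4))

builds on p205010 (kernel theorem, internal audit signed; external expert review pending)

Support file (`--supports stmt-CriticalPhenomena-4575`), QUANT lane typer seat prim-quant-stmt (gen 23), rung R8 of
`run/shared/lean/prim/quant/LADDER.md`.  Theorems only; standard axioms, no sorries.  Small lemmas used by `…QuantCornerStep`
(the CLAIM of the corner theorem): `IsFlowAtT.term_nonneg` (load terms are `≥ 0`), `IsFlowAtT.le_corner` (a compatible pair `(l₂,h₁)`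
carries at most `min(μ l₂, μ h₁/usage(l₂,h₁))`), support-counting lemmas `card_filter_pos_mono`, `card_filter_pos_strict`,
`exists_ne_pos_of_lt_sum`, and the column-load update `sum_usage_add_indicator`.

[this work]; `…QuantLawDecFlows` (typer g22), `…QuantFlowUncross` (this seat).  Nothing here is cited as a published result.  The gluing
rows served [cite: KozmaNitzan2024, Conjecture 3 (p. 15)]; product measure [cite: Grimmett1999, §1.3 p. 10].
-/

noncomputable section

namespace Summit.CriticalPhenomena.PercolationContinuityZ3.Theorems

namespace Quant

open Finset

namespace LawDec

/-! ### Bookkeeping for the corner step -/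

/-- every load term `usage(l,h)·f l h` of a witness is nonnegative (`0 < x < 1`). [this work] -/
theorem IsFlowAtT.term_nonneg {x T : ℝ} {j' M : ℕ} {μ : ℕ → ℝ} {f : ℕ → ℕ → ℝ} (hF : IsFlowAtT x T j' M μ f)
    (hx0 : 0 < x) (hx1 : x < 1) (l h : ℕ) : 0 ≤ usage x T j' l h * f l h := by
  obtain ⟨hf0, hsupp, -, -⟩ := hF
  rcases (hf0 l h).lt_or_eq with hpos | h0
  · obtain ⟨hlj, hlow, -, hc⟩ := hsupp l h hpos
    have hlh : l < h := by
      rcases hc with hc | hc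
      · omega
      · by_contra hge
        push Not at hge
        have : (h : ℝ) ≤ l := by exact_mod_cast hge
        linarith
    exact mul_nonneg (usage_pos_of_compat x T j' l h hx0 hx1 hlow hlh hc).le hpos.le
  · rw [← h0, mul_zero]

/-- **a compatible pair `(l₂, h₁)` never carries more than `min(μ l₂, μ h₁ / usage(l₂,h₁))`** in a witness. [this work] -/
theorem IsFlowAtT.le_corner {x T : ℝ} {j' M : ℕ} {μ : ℕ → ℝ} {f : ℕ → ℕ → ℝ} (hF : IsFlowAtT x T j' M μ f)
    (hx0 : 0 < x) (hx1 : x < 1) (l₂ h₁ : ℕ) (hl2 : l₂ ≤ j') (hlow : 2 * (l₂ : ℝ) < T) (hh1M : h₁ ≤ M)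
    (hcomp : T < (l₂ : ℝ) + h₁) : f l₂ h₁ ≤ min (μ l₂) (μ h₁ / usage x T j' l₂ h₁) := by
  have hterm := hF.term_nonneg hx0 hx1
  obtain ⟨hf0, _, hrow, hcol⟩ := hF
  have hlh : l₂ < h₁ := by
    by_contra hge
    push Not at hge
    have : (h₁ : ℝ) ≤ l₂ := by exact_mod_cast hge
    linarith
  have hu := usage_pos_of_compat x T j' l₂ h₁ hx0 hx1 hlow hlh (Or.inr hcomp)
  refine le_min ?_ ?_
  · rw [← hrow l₂ hl2 hlow]
    exact Finset.single_le_sum (f := fun h => f l₂ h) (fun h _ => hf0 l₂ h) (Finset.mem_range.2 (by omega))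
  · rw [le_div_iff₀ hu, mul_comm]
    refine le_trans ?_ (hcol h₁ hh1M (Or.inr (by linarith)))
    exact Finset.single_le_sum (f := fun l => usage x T j' l h₁ * f l h₁) (fun l _ => hterm l h₁)
      (Finset.mem_range.2 (by omega))

/-- support counts are monotone under pointwise domination of positivity. -/
theorem card_filter_pos_mono (s : Finset ℕ) (a : ℕ) (φ ψ : ℕ → ℝ)
    (himp : ∀ i ∈ s, i ≠ a → 0 < ψ i → 0 < φ i) :
    (s.filter (fun i => i ≠ a ∧ 0 < ψ i)).card ≤ (s.filter (fun i => i ≠ a ∧ 0 < φ i)).card := by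
  apply Finset.card_le_card
  intro i
  simp only [Finset.mem_filter]
  exact fun ⟨hi, hne, hpos⟩ => ⟨hi, hne, himp i hi hne hpos⟩

/-- … and drop strictly when one positive entry dies. -/
theorem card_filter_pos_strict (s : Finset ℕ) (a : ℕ) (φ ψ : ℕ → ℝ)
    (himp : ∀ i ∈ s, i ≠ a → 0 < ψ i → 0 < φ i) (b : ℕ) (hb : b ∈ s) (hba : b ≠ a) (hφ : 0 < φ b)
    (hψ : ¬ 0 < ψ b) :
    (s.filter (fun i => i ≠ a ∧ 0 < ψ i)).card < (s.filter (fun i => i ≠ a ∧ 0 < φ i)).card := by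
  apply Finset.card_lt_card
  rw [Finset.ssubset_iff_of_subset]
  · refine ⟨b, ?_, ?_⟩
    · simp only [Finset.mem_filter]; exact ⟨hb, hba, hφ⟩
    · simp only [Finset.mem_filter]; exact fun ⟨_, _, h⟩ => hψ h
  · intro i
    simp only [Finset.mem_filter]
    exact fun ⟨hi, hne, hpos⟩ => ⟨hi, hne, himp i hi hne hpos⟩

/-- if one term is smaller than the sum, another term is positive. -/
theorem exists_ne_pos_of_lt_sum (s : Finset ℕ) (φ : ℕ → ℝ) (a : ℕ) (ha : a ∈ s) (hlt : φ a < ∑ i ∈ s, φ i) :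
    ∃ b ∈ s, b ≠ a ∧ 0 < φ b := by
  have h1 : ∑ i ∈ s, (if i = a then φ i else 0) = φ a := by
    rw [Finset.sum_eq_single a]
    · rw [if_pos rfl]
    · intro i _ hne; rw [if_neg hne]
    · intro hna; exact absurd ha hna
  rw [← h1] at hlt
  obtain ⟨b, hb, hlt'⟩ := Finset.exists_lt_of_sum_lt hlt
  by_cases hba : b = a
  · rw [if_pos hba] at hlt'; exact absurd hlt' (lt_irrefl _)
  · rw [if_neg hba] at hlt'; exact ⟨b, hb, hba, hlt'⟩

/-- adding `c·[l = a]` to a column changes its load by `c·usage(a,h)`. -/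
theorem sum_usage_add_indicator (x T : ℝ) (j' h : ℕ) (φ : ℕ → ℝ) (a : ℕ) (ha : a ∈ Finset.range (j' + 1)) (c : ℝ) :
    ∑ l ∈ Finset.range (j' + 1), usage x T j' l h * (φ l + c * (if l = a then (1:ℝ) else 0))
      = ∑ l ∈ Finset.range (j' + 1), usage x T j' l h * φ l + c * usage x T j' a h := by
  have e : ∀ l, usage x T j' l h * (φ l + c * (if l = a then (1:ℝ) else 0))
      = usage x T j' l h * φ l + (c * usage x T j' l h) * (if l = a then (1:ℝ) else 0) := fun l => by ring
  simp only [e, Finset.sum_add_distrib]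
  rw [sum_mul_indicator_eq _ (fun l => c * usage x T j' l h) a ha]

end LawDec

end Quant

end Summit.CriticalPhenomena.PercolationContinuityZ3.Theorems
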